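import Literature.Probability.RandomPlanarGeometry.HexSAWRotSurfaceFugacity
import HarnessLib

/-!
# Beaton's rotated strip at criticality: the arch classes in the height limit — critical arch identity and the two locality budgets (`y = 1`)

Topic `Literature/Probability/RandomPlanarGeometry`; lane «pcv-sawmu», seat a-idea-1 gen 24 (door 5 «ROT-ARCH-LIMIT»; technique lens: bridge /
renewal decompositions WITH EXPLICIT RATES — here: LOCALITY of Beaton's strip classes in the width and in the height, the truncation error
being controlled EXACTLY by one finite-data quantity each time).  CLASS S: imports only the tree's `HexSAWRotSurfaceFugacity`.

Setting (tree `HexSAWRotStripClasses`, `HexSAWRotStripLimit`, `HexSAWRotStripLateralNull`): Beaton's rotated-honeycomb strip domain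
`D(H, W)` (`HV.rotStripV H W`), the right-started generating functions at `x = x_c` of the walks from the mid-edge `a` sorted by exit class —
bottom-out `A^O_{H,W} := rotGF ((rotStripV H W).erase wOut) IsRotBotOut`, bottom-in `A^I_{H,W}` (`IsRotBotIn`), lateral `E_{H,W}`
(`IsRotLatDart H W`), top = bridges `B_{H,W} = rotStripBR H W` (`IsRotTopDart H`), closing `P_{H,W}` (`IsRotCloseDart`) — Beaton's finite
identity (tree `HV.rotStrip_identity`, Proposition 4 at `y = 1`) `c_O A^O_{H,W} + c_I A^I_{H,W} + c_E E_{H,W} + c_B B_{H,W} + c_P P_{H,W} = 2 x_c cos(π/16)`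
(`H, W ≥ 1`; `c_O = 2 sin(3π/16)`, `c_I = 2 sin(π/16)`, `c_E = 2 cos(3π/16)`, `c_B = 2 cos(π/16)`, `c_P = 2 cos(7π/16)`), and ITS WIDTH LIMIT,
which the TREE already has: `HV.tendsto_rotGF_width` (the width-independent classes converge to their suprema `A^O_H := ⨆_W A^O_{H,W}`, …),
`HV.tendsto_rotStripLat_zero` (`E_{H,W} → 0`) and **`HV.rotStrip_identity_lim`**: `c_O A^O_H + c_I A^I_H + c_B B_H + c_P P_H = 2 x_c cos(π/16)`
(`H ≥ 1`), plus `B_H → 0` (`HV.tendsto_iSup_rotStripBR`) with the log rate (`HV.iSup_rotStripBR_le_log`).  This file adds: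

* W. named a-priori bounds and suprema facts for the three arch-type classes (`rotStripOut_le(_all)`, `rotStripOut_bddAbove`,
  `tendsto_rotStripOut` (= the tree's `tendsto_rotGF_width` instantiated), `rotStripOut_le_iSup`; same for `In`, `Close`) — helpers;
* L. `rot_arch_functional_eq` — the ARCH FUNCTIONAL `F_H := c_O A^O_H + c_I A^I_H + c_P P_H` equals `2 x_c cos(π/16) − c_B B_H`, and is
  STRICTLY below `2 x_c cos(π/16)` at every finite height (`rot_arch_functional_lt`, tree `iSup_rotStripBR_pos`);
* B. **LOCALITY IN THE WIDTH — the width budget `rot_width_budget`**: for `H, W ≥ 1`,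
  `c_O (A^O_H − A^O_{H,W}) + c_I (A^I_H − A^I_{H,W}) + c_B (B_H − B_{H,W}) + c_P (P_H − P_{H,W}) = c_E E_{H,W}` EXACTLY (finite identity minus
  limit identity): the total width-truncation error of the four growing classes IS the lateral class; hence
  **`iSup_rotStripBR_sub_le_rotStripLat`: `0 ≤ B_H − B_{H,W} ≤ E_{H,W}`** and the weighted forms for each class;
* H. **LOCALITY IN THE HEIGHT**: `rotStripCls_mono_height`, `iSup_rotStripOut_mono_height` & co. (the width limits are non-decreasing in `H`),
  `rot_arch_functional_mono`, **`tendsto_rot_arch_functional`** (`F_{H+1} → 2 x_c cos(π/16)`), the HEIGHT LIMITS `A^O_∞ := ⨆_H A^O_{H+1}`,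
  `A^I_∞`, `P_∞` exist = the rotated half-plane's arch generating functions at `x_c` are FINITE (`tendsto_iSup_rotStripOut_atTop` & co.), the
  **CRITICAL ARCH IDENTITY `rot_critical_arch_identity`: `c_O A^O_∞ + c_I A^I_∞ + c_P P_∞ = 2 x_c cos(π/16)`** (rotated-frame twin of the
  parallel frame's `A(x_c) = lim_T A_T`, tree `HV.tendsto_stripAlim`), and the **height budget `rot_height_budget`**:
  `c_O (A^O_∞ − A^O_{H+1}) + c_I (A^I_∞ − A^I_{H+1}) + c_P (P_∞ − P_{H+1}) = c_B B_{H+1}` EXACTLY — every arch class converges to its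
  half-plane value with error at most `(c_B/c) B_{H+1}(x_c)`, `> 0` at every height, and `≤ C (log H)^{−1/3}` by the tree
  (`rot_arch_deficit_le_log`, `iSup_rotStripOut_deficit_le_log`).

Everything is glue on the tree's identities and limits: no new combinatorics, no constants beyond Beaton's coefficients.  Honest label
(author's expectation): CONSOLIDATION (Beaton 2014 §4 at `y = 1`; the EXISTENCE of the height limits is explicit in print (arXiv v3 p. 17),
the critical arch identity is implicit in §4 + App. A (`B(x_c,1) = 0`; Prop. 11's proof takes this limit for `y > y†`); tokens AL-1/AL-2,
ref g44 §77.9).  NORMALISATION: `B_{H,W} = rotStripBR H W` is the tree's RIGHT-STARTED HALF `B^{→}` of Beaton's symmetric `B_{T,L}`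
(printed `B_T = 2·B^{→}`, `c_G = 4 x_c cos(π/16) = 2·K`): every constant below is against `B^{→}` — the two budget equalities are the lane's phrasing of «locality with an explicit rate»: the rate is the lateral class
(width) / the bridge class (height), both tree-certified to vanish, the latter at the tree's `(log H)^{−1/3}`.

Sources: N. R. Beaton, J. Phys. A 47 (2014) 075003 (arXiv:1210.0274v3), §2.2 (classes of `D_{T,L}`; Proposition 4, the identity, arXiv v3 p. 5), §4
(arXiv v3 p. 16: identity (21), «`A^O_{T,L}, A^I_{T,L}, B_{T,L}, P_{T,L}` actually increase with `L`», the limits `L → ∞` and the limit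
identity (22); p. 17: Corollary 13 `E_T(x_c, y) = 0`, and «`A^O_T(x_c,1), A^I_T(x_c,1), P_T(x_c,1)` all increase with `T` … have limits»;
`B(x_c,1) = 0` via Appendix A, Corollary 15, p. 19); H. Duminil-Copin, S. Smirnov, Ann. Math. 175 (2012) 1653–1665, §3 (parallel
frame: identity in the limit, `B_T → 0`, `A(x_c)` finite); A. Glazman, I. Manolescu, arXiv:1708.00395v3, Cor. 2.3 and Prop. 1.1.
-/

noncomputable section

open Finset Filter Topology

namespace Literature.Probability.RandomPlanarGeometry.SAW.HV

/-! ### W. Width monotonicity, a priori bounds and width limits of the bottom-out, bottom-in and closing classes -/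

/-- Every exit class whose predicate does not depend on the width is non-decreasing in the width (the domain grows).
[cite: Beaton2014RotatedHoneycomb, §4 (arXiv v3 p. 16: «A^O_{T,L}, A^I_{T,L}, B_{T,L} and P_{T,L} actually increase with L»)] -/
theorem rotStripCls_mono_width (H : ℕ) (cls : HV × HV → Prop) [DecidablePred cls] :
    Monotone fun Wd : ℕ => rotGF ((rotStripV H Wd).erase wOut) cls :=
  fun _ _ h => rotGF_mono (erase_subset_erase _ (rotStripV_mono_width h)) cls

/-- Every exit class whose predicate does not depend on the height is non-decreasing in the height (the domain grows).
[cite: Beaton2014RotatedHoneycomb, §4 (arXiv v3 p. 17: A^O_T, A^I_T, P_T increase with T)] -/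
theorem rotStripCls_mono_height {H H' : ℕ} (h : H ≤ H') (Wd : ℕ) (cls : HV × HV → Prop) [DecidablePred cls] :
    rotGF ((rotStripV H Wd).erase wOut) cls ≤ rotGF ((rotStripV H' Wd).erase wOut) cls :=
  rotGF_mono (erase_subset_erase _ (rotStripV_mono_height h)) cls

/-- `c_O A^O_{H,W} ≤ 2 x_c cos(π/16)` for `H, W ≥ 1` (all other terms of the identity are `≥ 0`). [cite: Beaton2014RotatedHoneycomb, Proposition 4] -/
theorem rotStripOut_le {H Wd : ℕ} (hH : 1 ≤ H) (hW : 1 ≤ Wd) :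
    2 * Real.sin (3 * Real.pi / 16) * rotGF ((rotStripV H Wd).erase wOut) IsRotBotOut ≤
      2 * hexCriticalFugacity * Real.cos (Real.pi / 16) := by
  obtain ⟨cO, cI, cE, cP, cB⟩ := rot_coeff_pos
  have e := rotStrip_identity hH hW
  have h1 := mul_nonneg cI.le (rotGF_nonneg ((rotStripV H Wd).erase wOut) IsRotBotIn)
  have h2 := mul_nonneg cE.le (rotGF_nonneg ((rotStripV H Wd).erase wOut) (IsRotLatDart H Wd))
  have h3 := mul_nonneg (by linarith : (0 : ℝ) ≤ 2 * Real.cos (Real.pi / 16))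
    (rotGF_nonneg ((rotStripV H Wd).erase wOut) (IsRotTopDart H))
  have h4 := mul_nonneg cP.le (rotGF_nonneg ((rotStripV H Wd).erase wOut) IsRotCloseDart)
  linarith

/-- `c_I A^I_{H,W} ≤ 2 x_c cos(π/16)` for `H, W ≥ 1`. [cite: Beaton2014RotatedHoneycomb, Proposition 4] -/
theorem rotStripIn_le {H Wd : ℕ} (hH : 1 ≤ H) (hW : 1 ≤ Wd) :
    2 * Real.sin (Real.pi / 16) * rotGF ((rotStripV H Wd).erase wOut) IsRotBotIn ≤
      2 * hexCriticalFugacity * Real.cos (Real.pi / 16) := by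
  obtain ⟨cO, cI, cE, cP, cB⟩ := rot_coeff_pos
  have e := rotStrip_identity hH hW
  have h1 := mul_nonneg cO.le (rotGF_nonneg ((rotStripV H Wd).erase wOut) IsRotBotOut)
  have h2 := mul_nonneg cE.le (rotGF_nonneg ((rotStripV H Wd).erase wOut) (IsRotLatDart H Wd))
  have h3 := mul_nonneg (by linarith : (0 : ℝ) ≤ 2 * Real.cos (Real.pi / 16))
    (rotGF_nonneg ((rotStripV H Wd).erase wOut) (IsRotTopDart H))
  have h4 := mul_nonneg cP.le (rotGF_nonneg ((rotStripV H Wd).erase wOut) IsRotCloseDart)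
  linarith

/-- `c_P P_{H,W} ≤ 2 x_c cos(π/16)` for `H, W ≥ 1`. [cite: Beaton2014RotatedHoneycomb, Proposition 4] -/
theorem rotStripClose_le {H Wd : ℕ} (hH : 1 ≤ H) (hW : 1 ≤ Wd) :
    2 * Real.cos (7 * Real.pi / 16) * rotGF ((rotStripV H Wd).erase wOut) IsRotCloseDart ≤
      2 * hexCriticalFugacity * Real.cos (Real.pi / 16) := by
  obtain ⟨cO, cI, cE, cP, cB⟩ := rot_coeff_pos
  have e := rotStrip_identity hH hW
  have h1 := mul_nonneg cO.le (rotGF_nonneg ((rotStripV H Wd).erase wOut) IsRotBotOut)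
  have h2 := mul_nonneg cE.le (rotGF_nonneg ((rotStripV H Wd).erase wOut) (IsRotLatDart H Wd))
  have h3 := mul_nonneg (by linarith : (0 : ℝ) ≤ 2 * Real.cos (Real.pi / 16))
    (rotGF_nonneg ((rotStripV H Wd).erase wOut) (IsRotTopDart H))
  have h4 := mul_nonneg cI.le (rotGF_nonneg ((rotStripV H Wd).erase wOut) IsRotBotIn)
  linarith

/-- … for EVERY width (width `0` sits below width `1`). [cite: Beaton2014RotatedHoneycomb, Proposition 4 (§2.2) and §4 (arXiv v3 p. 16)] -/
theorem rotStripOut_le_all {H : ℕ} (hH : 1 ≤ H) (Wd : ℕ) :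
    2 * Real.sin (3 * Real.pi / 16) * rotGF ((rotStripV H Wd).erase wOut) IsRotBotOut ≤
      2 * hexCriticalFugacity * Real.cos (Real.pi / 16) := by
  obtain ⟨cO, -, -, -, -⟩ := rot_coeff_pos
  have hm := rotStripCls_mono_width H IsRotBotOut (Nat.le_succ Wd)
  have := rotStripOut_le hH (Nat.succ_pos Wd)
  nlinarith

/-- … for every width. [cite: Beaton2014RotatedHoneycomb, Proposition 4 (§2.2) and §4 (arXiv v3 p. 16)] -/
theorem rotStripIn_le_all {H : ℕ} (hH : 1 ≤ H) (Wd : ℕ) :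
    2 * Real.sin (Real.pi / 16) * rotGF ((rotStripV H Wd).erase wOut) IsRotBotIn ≤
      2 * hexCriticalFugacity * Real.cos (Real.pi / 16) := by
  obtain ⟨-, cI, -, -, -⟩ := rot_coeff_pos
  have hm := rotStripCls_mono_width H IsRotBotIn (Nat.le_succ Wd)
  have := rotStripIn_le hH (Nat.succ_pos Wd)
  nlinarith

/-- … for every width. [cite: Beaton2014RotatedHoneycomb, Proposition 4 (§2.2) and §4 (arXiv v3 p. 16)] -/
theorem rotStripClose_le_all {H : ℕ} (hH : 1 ≤ H) (Wd : ℕ) :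
    2 * Real.cos (7 * Real.pi / 16) * rotGF ((rotStripV H Wd).erase wOut) IsRotCloseDart ≤
      2 * hexCriticalFugacity * Real.cos (Real.pi / 16) := by
  obtain ⟨-, -, -, cP, -⟩ := rot_coeff_pos
  have hm := rotStripCls_mono_width H IsRotCloseDart (Nat.le_succ Wd)
  have := rotStripClose_le hH (Nat.succ_pos Wd)
  nlinarith

/-- `W ↦ A^O_{H,W}` is bounded above (`H ≥ 1`). [cite: Beaton2014RotatedHoneycomb, §4 (arXiv v3 p. 16: the limits L → ∞ exist)] -/
theorem rotStripOut_bddAbove {H : ℕ} (hH : 1 ≤ H) :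
    BddAbove (Set.range fun Wd : ℕ => rotGF ((rotStripV H Wd).erase wOut) IsRotBotOut) := by
  obtain ⟨cO, -, -, -, -⟩ := rot_coeff_pos
  refine ⟨2 * hexCriticalFugacity * Real.cos (Real.pi / 16) / (2 * Real.sin (3 * Real.pi / 16)), ?_⟩
  rintro _ ⟨Wd, rfl⟩
  rw [le_div_iff₀ cO, mul_comm]
  exact rotStripOut_le_all hH Wd

/-- `W ↦ A^I_{H,W}` is bounded above (`H ≥ 1`). [cite: Beaton2014RotatedHoneycomb, §4 (arXiv v3 p. 16)] -/
theorem rotStripIn_bddAbove {H : ℕ} (hH : 1 ≤ H) :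
    BddAbove (Set.range fun Wd : ℕ => rotGF ((rotStripV H Wd).erase wOut) IsRotBotIn) := by
  obtain ⟨-, cI, -, -, -⟩ := rot_coeff_pos
  refine ⟨2 * hexCriticalFugacity * Real.cos (Real.pi / 16) / (2 * Real.sin (Real.pi / 16)), ?_⟩
  rintro _ ⟨Wd, rfl⟩
  rw [le_div_iff₀ cI, mul_comm]
  exact rotStripIn_le_all hH Wd

/-- `W ↦ P_{H,W}` is bounded above (`H ≥ 1`). [cite: Beaton2014RotatedHoneycomb, §4 (arXiv v3 p. 16)] -/
theorem rotStripClose_bddAbove {H : ℕ} (hH : 1 ≤ H) :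
    BddAbove (Set.range fun Wd : ℕ => rotGF ((rotStripV H Wd).erase wOut) IsRotCloseDart) := by
  obtain ⟨-, -, -, cP, -⟩ := rot_coeff_pos
  refine ⟨2 * hexCriticalFugacity * Real.cos (Real.pi / 16) / (2 * Real.cos (7 * Real.pi / 16)), ?_⟩
  rintro _ ⟨Wd, rfl⟩
  rw [le_div_iff₀ cP, mul_comm]
  exact rotStripClose_le_all hH Wd

/-- `A^O_H := lim_W A^O_{H,W}` exists (`= ⨆_W`), `H ≥ 1` — the tree's `tendsto_rotGF_width`, instantiated. [cite: Beaton2014RotatedHoneycomb, §4 (arXiv v3 p. 16: A^O_T(x_c,y) := lim_L A^O_{T,L})] -/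
theorem tendsto_rotStripOut {H : ℕ} (hH : 1 ≤ H) :
    Tendsto (fun Wd : ℕ => rotGF ((rotStripV H Wd).erase wOut) IsRotBotOut) atTop
      (𝓝 (⨆ Wd : ℕ, rotGF ((rotStripV H Wd).erase wOut) IsRotBotOut)) :=
  tendsto_rotGF_width hH IsRotBotOut rot_coeff_pos.1 fun _ hW => rotStripOut_le hH hW

/-- `A^I_H := lim_W A^I_{H,W}` exists, `H ≥ 1` — the tree's `tendsto_rotGF_width`, instantiated. [cite: Beaton2014RotatedHoneycomb, §4 (arXiv v3 p. 16)] -/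
theorem tendsto_rotStripIn {H : ℕ} (hH : 1 ≤ H) :
    Tendsto (fun Wd : ℕ => rotGF ((rotStripV H Wd).erase wOut) IsRotBotIn) atTop
      (𝓝 (⨆ Wd : ℕ, rotGF ((rotStripV H Wd).erase wOut) IsRotBotIn)) :=
  tendsto_rotGF_width hH IsRotBotIn rot_coeff_pos.2.1 fun _ hW => rotStripIn_le hH hW

/-- `P_H := lim_W P_{H,W}` exists, `H ≥ 1` — the tree's `tendsto_rotGF_width`, instantiated. [cite: Beaton2014RotatedHoneycomb, §4 (arXiv v3 p. 16)] -/
theorem tendsto_rotStripClose {H : ℕ} (hH : 1 ≤ H) :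
    Tendsto (fun Wd : ℕ => rotGF ((rotStripV H Wd).erase wOut) IsRotCloseDart) atTop
      (𝓝 (⨆ Wd : ℕ, rotGF ((rotStripV H Wd).erase wOut) IsRotCloseDart)) :=
  tendsto_rotGF_width hH IsRotCloseDart rot_coeff_pos.2.2.2.1 fun _ hW => rotStripClose_le hH hW

/-- Finite width below the width limit, bottom-out class. [cite: Beaton2014RotatedHoneycomb, §4 (arXiv v3 p. 16)] -/
theorem rotStripOut_le_iSup {H : ℕ} (hH : 1 ≤ H) (Wd : ℕ) :
    rotGF ((rotStripV H Wd).erase wOut) IsRotBotOut ≤ ⨆ Wd : ℕ, rotGF ((rotStripV H Wd).erase wOut) IsRotBotOut :=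
  le_ciSup (rotStripOut_bddAbove hH) Wd

/-- Finite width below the width limit, bottom-in class. [cite: Beaton2014RotatedHoneycomb, §4 (arXiv v3 p. 16)] -/
theorem rotStripIn_le_iSup {H : ℕ} (hH : 1 ≤ H) (Wd : ℕ) :
    rotGF ((rotStripV H Wd).erase wOut) IsRotBotIn ≤ ⨆ Wd : ℕ, rotGF ((rotStripV H Wd).erase wOut) IsRotBotIn :=
  le_ciSup (rotStripIn_bddAbove hH) Wd

/-- Finite width below the width limit, closing class. [cite: Beaton2014RotatedHoneycomb, §4 (arXiv v3 p. 16)] -/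
theorem rotStripClose_le_iSup {H : ℕ} (hH : 1 ≤ H) (Wd : ℕ) :
    rotGF ((rotStripV H Wd).erase wOut) IsRotCloseDart ≤ ⨆ Wd : ℕ, rotGF ((rotStripV H Wd).erase wOut) IsRotCloseDart :=
  le_ciSup (rotStripClose_bddAbove hH) Wd

/-! ### L. The arch functional (on the tree's limit identity `rotStrip_identity_lim`) -/

/-- **The arch functional** `F_H := c_O A^O_H + c_I A^I_H + c_P P_H` equals `2 x_c cos(π/16) − c_B B_H` (`H ≥ 1`).
[cite: Beaton2014RotatedHoneycomb, §4 (the limit identity, arXiv v3 pp. 16–17)] -/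
theorem rot_arch_functional_eq {H : ℕ} (hH : 1 ≤ H) :
    2 * Real.sin (3 * Real.pi / 16) * (⨆ Wd : ℕ, rotGF ((rotStripV H Wd).erase wOut) IsRotBotOut) +
      2 * Real.sin (Real.pi / 16) * (⨆ Wd : ℕ, rotGF ((rotStripV H Wd).erase wOut) IsRotBotIn) +
      2 * Real.cos (7 * Real.pi / 16) * (⨆ Wd : ℕ, rotGF ((rotStripV H Wd).erase wOut) IsRotCloseDart) =
    2 * hexCriticalFugacity * Real.cos (Real.pi / 16) - 2 * Real.cos (Real.pi / 16) * (⨆ Wd : ℕ, rotStripBR H Wd) := by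
  have := rotStrip_identity_lim hH
  linarith

/-- The arch functional is STRICTLY below `2 x_c cos(π/16)` at every finite height (`B_H > 0`, tree `iSup_rotStripBR_pos`).
[cite: Beaton2014RotatedHoneycomb, §4; DuminilCopinSmirnov2012, §3 (B_T > 0)] -/
theorem rot_arch_functional_lt {H : ℕ} (hH : 1 ≤ H) :
    2 * Real.sin (3 * Real.pi / 16) * (⨆ Wd : ℕ, rotGF ((rotStripV H Wd).erase wOut) IsRotBotOut) +
      2 * Real.sin (Real.pi / 16) * (⨆ Wd : ℕ, rotGF ((rotStripV H Wd).erase wOut) IsRotBotIn) +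
      2 * Real.cos (7 * Real.pi / 16) * (⨆ Wd : ℕ, rotGF ((rotStripV H Wd).erase wOut) IsRotCloseDart) <
    2 * hexCriticalFugacity * Real.cos (Real.pi / 16) := by
  obtain ⟨-, -, -, -, cB⟩ := rot_coeff_pos
  have h := rot_arch_functional_eq hH
  have hpos := iSup_rotStripBR_pos hH
  nlinarith

/-! ### B. Locality in the width: the budget -/

/-- **WIDTH BUDGET (locality of Beaton's strip classes in the width, EXACT):** for `H, W ≥ 1`,
`c_O (A^O_H − A^O_{H,W}) + c_I (A^I_H − A^I_{H,W}) + c_B (B_H − B_{H,W}) + c_P (P_H − P_{H,W}) = c_E E_{H,W}` — the total width-truncation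
error of the four growing classes is exactly the lateral class of the finite domain.
[cite: Beaton2014RotatedHoneycomb, Proposition 4 and §4 (finite identity minus limit identity)] -/
theorem rot_width_budget {H Wd : ℕ} (hH : 1 ≤ H) (hW : 1 ≤ Wd) :
    2 * Real.sin (3 * Real.pi / 16) * ((⨆ W : ℕ, rotGF ((rotStripV H W).erase wOut) IsRotBotOut) -
        rotGF ((rotStripV H Wd).erase wOut) IsRotBotOut) +
      2 * Real.sin (Real.pi / 16) * ((⨆ W : ℕ, rotGF ((rotStripV H W).erase wOut) IsRotBotIn) -
        rotGF ((rotStripV H Wd).erase wOut) IsRotBotIn) +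
      2 * Real.cos (Real.pi / 16) * ((⨆ W : ℕ, rotStripBR H W) - rotStripBR H Wd) +
      2 * Real.cos (7 * Real.pi / 16) * ((⨆ W : ℕ, rotGF ((rotStripV H W).erase wOut) IsRotCloseDart) -
        rotGF ((rotStripV H Wd).erase wOut) IsRotCloseDart) =
    2 * Real.cos (3 * Real.pi / 16) * rotGF ((rotStripV H Wd).erase wOut) (IsRotLatDart H Wd) := by
  have e := rotStrip_identity hH hW
  have l := rotStrip_identity_lim hH
  rw [← rotStripBR_eq_rotGF] at e
  linarith

/-- Width locality of the bridge class, weighted form: `c_B (B_H − B_{H,W}) ≤ c_E E_{H,W}` (`H, W ≥ 1`).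
[cite: Beaton2014RotatedHoneycomb, Proposition 4 and §4] -/
theorem two_mul_cos_mul_iSup_rotStripBR_sub_le {H Wd : ℕ} (hH : 1 ≤ H) (hW : 1 ≤ Wd) :
    2 * Real.cos (Real.pi / 16) * ((⨆ W : ℕ, rotStripBR H W) - rotStripBR H Wd) ≤
      2 * Real.cos (3 * Real.pi / 16) * rotGF ((rotStripV H Wd).erase wOut) (IsRotLatDart H Wd) := by
  obtain ⟨cO, cI, -, cP, -⟩ := rot_coeff_pos
  have b := rot_width_budget hH hW
  have h1 := mul_nonneg cO.le (sub_nonneg.2 (rotStripOut_le_iSup hH Wd))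
  have h2 := mul_nonneg cI.le (sub_nonneg.2 (rotStripIn_le_iSup hH Wd))
  have h4 := mul_nonneg cP.le (sub_nonneg.2 (rotStripClose_le_iSup hH Wd))
  linarith

/-- **WIDTH LOCALITY OF THE BRIDGE CLASS: `0 ≤ B_H − B_{H,W} ≤ E_{H,W}`** (`H, W ≥ 1`; `c_E = 2cos(3π/16) ≤ 2cos(π/16) = c_B`) — the
width-truncation error of Beaton's strip-bridge generating function at `x_c` is at most the lateral class of the same finite domain
(which the tree proves tends to `0`, `tendsto_rotStripLat_zero`).
[cite: Beaton2014RotatedHoneycomb, Proposition 4 (§2.2) and §4 (identity (22), Corollary 13; arXiv v3 pp. 16–17)] -/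
theorem iSup_rotStripBR_sub_le_rotStripLat {H Wd : ℕ} (hH : 1 ≤ H) (hW : 1 ≤ Wd) :
    (⨆ W : ℕ, rotStripBR H W) - rotStripBR H Wd ≤ rotGF ((rotStripV H Wd).erase wOut) (IsRotLatDart H Wd) := by
  obtain ⟨-, -, cE, -, cB⟩ := rot_coeff_pos
  have h := two_mul_cos_mul_iSup_rotStripBR_sub_le hH hW
  have hcos : Real.cos (3 * Real.pi / 16) ≤ Real.cos (Real.pi / 16) :=
    Real.cos_le_cos_of_nonneg_of_le_pi (by positivity) (by linarith [Real.pi_pos]) (by linarith [Real.pi_pos])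
  have hE := rotGF_nonneg ((rotStripV H Wd).erase wOut) (IsRotLatDart H Wd)
  have hd : 0 ≤ (⨆ W : ℕ, rotStripBR H W) - rotStripBR H Wd := sub_nonneg.2 (rotStripBR_le_iSup hH Wd)
  nlinarith

/-- The width-truncation error of the bridge class is nonnegative. [cite: Beaton2014RotatedHoneycomb, §4 (B_{T,L} increases to B_T)] -/
theorem iSup_rotStripBR_sub_nonneg {H : ℕ} (hH : 1 ≤ H) (Wd : ℕ) : 0 ≤ (⨆ W : ℕ, rotStripBR H W) - rotStripBR H Wd :=
  sub_nonneg.2 (rotStripBR_le_iSup hH Wd)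

/-- Width locality of the bottom-out arch class, weighted: `c_O (A^O_H − A^O_{H,W}) ≤ c_E E_{H,W}`. [cite: Beaton2014RotatedHoneycomb, Proposition 4 and §4] -/
theorem two_mul_sin_mul_iSup_rotStripOut_sub_le {H Wd : ℕ} (hH : 1 ≤ H) (hW : 1 ≤ Wd) :
    2 * Real.sin (3 * Real.pi / 16) * ((⨆ W : ℕ, rotGF ((rotStripV H W).erase wOut) IsRotBotOut) -
        rotGF ((rotStripV H Wd).erase wOut) IsRotBotOut) ≤
      2 * Real.cos (3 * Real.pi / 16) * rotGF ((rotStripV H Wd).erase wOut) (IsRotLatDart H Wd) := by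
  obtain ⟨-, cI, -, cP, cB⟩ := rot_coeff_pos
  have b := rot_width_budget hH hW
  have h2 := mul_nonneg cI.le (sub_nonneg.2 (rotStripIn_le_iSup hH Wd))
  have h3 := mul_nonneg (by linarith : (0 : ℝ) ≤ 2 * Real.cos (Real.pi / 16)) (sub_nonneg.2 (rotStripBR_le_iSup hH Wd))
  have h4 := mul_nonneg cP.le (sub_nonneg.2 (rotStripClose_le_iSup hH Wd))
  linarith

/-- Width locality of the bottom-in arch class, weighted: `c_I (A^I_H − A^I_{H,W}) ≤ c_E E_{H,W}`. [cite: Beaton2014RotatedHoneycomb, Proposition 4 and §4] -/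
theorem two_mul_sin_mul_iSup_rotStripIn_sub_le {H Wd : ℕ} (hH : 1 ≤ H) (hW : 1 ≤ Wd) :
    2 * Real.sin (Real.pi / 16) * ((⨆ W : ℕ, rotGF ((rotStripV H W).erase wOut) IsRotBotIn) -
        rotGF ((rotStripV H Wd).erase wOut) IsRotBotIn) ≤
      2 * Real.cos (3 * Real.pi / 16) * rotGF ((rotStripV H Wd).erase wOut) (IsRotLatDart H Wd) := by
  obtain ⟨cO, -, -, cP, cB⟩ := rot_coeff_pos
  have b := rot_width_budget hH hW
  have h1 := mul_nonneg cO.le (sub_nonneg.2 (rotStripOut_le_iSup hH Wd))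
  have h3 := mul_nonneg (by linarith : (0 : ℝ) ≤ 2 * Real.cos (Real.pi / 16)) (sub_nonneg.2 (rotStripBR_le_iSup hH Wd))
  have h4 := mul_nonneg cP.le (sub_nonneg.2 (rotStripClose_le_iSup hH Wd))
  linarith

/-- Width locality of the closing class, weighted: `c_P (P_H − P_{H,W}) ≤ c_E E_{H,W}`. [cite: Beaton2014RotatedHoneycomb, Proposition 4 and §4] -/
theorem two_mul_cos_mul_iSup_rotStripClose_sub_le {H Wd : ℕ} (hH : 1 ≤ H) (hW : 1 ≤ Wd) :
    2 * Real.cos (7 * Real.pi / 16) * ((⨆ W : ℕ, rotGF ((rotStripV H W).erase wOut) IsRotCloseDart) -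
        rotGF ((rotStripV H Wd).erase wOut) IsRotCloseDart) ≤
      2 * Real.cos (3 * Real.pi / 16) * rotGF ((rotStripV H Wd).erase wOut) (IsRotLatDart H Wd) := by
  obtain ⟨cO, cI, -, -, cB⟩ := rot_coeff_pos
  have b := rot_width_budget hH hW
  have h1 := mul_nonneg cO.le (sub_nonneg.2 (rotStripOut_le_iSup hH Wd))
  have h2 := mul_nonneg cI.le (sub_nonneg.2 (rotStripIn_le_iSup hH Wd))
  have h3 := mul_nonneg (by linarith : (0 : ℝ) ≤ 2 * Real.cos (Real.pi / 16)) (sub_nonneg.2 (rotStripBR_le_iSup hH Wd))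
  linarith

/-- The lateral class from below: `E_{H,W} ≥ (c_B/c_E)(B_H − B_{H,W}) ≥ B_H − B_{H,W}` — a lateral exit costs at least the missing
bridge mass. [cite: Beaton2014RotatedHoneycomb, Proposition 4 and §4] -/
theorem rotStripLat_ge_iSup_rotStripBR_sub {H Wd : ℕ} (hH : 1 ≤ H) (hW : 1 ≤ Wd) :
    (⨆ W : ℕ, rotStripBR H W) - rotStripBR H Wd ≤ rotGF ((rotStripV H Wd).erase wOut) (IsRotLatDart H Wd) :=
  iSup_rotStripBR_sub_le_rotStripLat hH hW

/-! ### H. Locality in the height: monotone limits, the arch functional, the critical arch identity and the height budget -/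

/-- `A^O_H ≤ A^O_{H'}` for `1 ≤ H ≤ H'`. [cite: Beaton2014RotatedHoneycomb, §4 (arXiv v3 p. 17)] -/
theorem iSup_rotStripOut_mono_height {H H' : ℕ} (hH : 1 ≤ H) (h : H ≤ H') :
    (⨆ Wd : ℕ, rotGF ((rotStripV H Wd).erase wOut) IsRotBotOut) ≤ ⨆ Wd : ℕ, rotGF ((rotStripV H' Wd).erase wOut) IsRotBotOut :=
  ciSup_le fun Wd => (rotStripCls_mono_height h Wd IsRotBotOut).trans (rotStripOut_le_iSup (hH.trans h) Wd)

/-- `A^I_H ≤ A^I_{H'}` for `1 ≤ H ≤ H'`. [cite: Beaton2014RotatedHoneycomb, §4 (arXiv v3 p. 17)] -/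
theorem iSup_rotStripIn_mono_height {H H' : ℕ} (hH : 1 ≤ H) (h : H ≤ H') :
    (⨆ Wd : ℕ, rotGF ((rotStripV H Wd).erase wOut) IsRotBotIn) ≤ ⨆ Wd : ℕ, rotGF ((rotStripV H' Wd).erase wOut) IsRotBotIn :=
  ciSup_le fun Wd => (rotStripCls_mono_height h Wd IsRotBotIn).trans (rotStripIn_le_iSup (hH.trans h) Wd)

/-- `P_H ≤ P_{H'}` for `1 ≤ H ≤ H'`. [cite: Beaton2014RotatedHoneycomb, §4 (arXiv v3 p. 17)] -/
theorem iSup_rotStripClose_mono_height {H H' : ℕ} (hH : 1 ≤ H) (h : H ≤ H') :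
    (⨆ Wd : ℕ, rotGF ((rotStripV H Wd).erase wOut) IsRotCloseDart) ≤
      ⨆ Wd : ℕ, rotGF ((rotStripV H' Wd).erase wOut) IsRotCloseDart :=
  ciSup_le fun Wd => (rotStripCls_mono_height h Wd IsRotCloseDart).trans (rotStripClose_le_iSup (hH.trans h) Wd)

/-- The arch functional `F_H` is non-decreasing in `H ≥ 1`. [cite: Beaton2014RotatedHoneycomb, §4 (arXiv v3 p. 17)] -/
theorem rot_arch_functional_mono {H H' : ℕ} (hH : 1 ≤ H) (h : H ≤ H') :
    2 * Real.sin (3 * Real.pi / 16) * (⨆ Wd : ℕ, rotGF ((rotStripV H Wd).erase wOut) IsRotBotOut) +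
        2 * Real.sin (Real.pi / 16) * (⨆ Wd : ℕ, rotGF ((rotStripV H Wd).erase wOut) IsRotBotIn) +
        2 * Real.cos (7 * Real.pi / 16) * (⨆ Wd : ℕ, rotGF ((rotStripV H Wd).erase wOut) IsRotCloseDart) ≤
      2 * Real.sin (3 * Real.pi / 16) * (⨆ Wd : ℕ, rotGF ((rotStripV H' Wd).erase wOut) IsRotBotOut) +
        2 * Real.sin (Real.pi / 16) * (⨆ Wd : ℕ, rotGF ((rotStripV H' Wd).erase wOut) IsRotBotIn) +
        2 * Real.cos (7 * Real.pi / 16) * (⨆ Wd : ℕ, rotGF ((rotStripV H' Wd).erase wOut) IsRotCloseDart) := by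
  obtain ⟨cO, cI, -, cP, -⟩ := rot_coeff_pos
  have h1 := mul_le_mul_of_nonneg_left (iSup_rotStripOut_mono_height hH h) cO.le
  have h2 := mul_le_mul_of_nonneg_left (iSup_rotStripIn_mono_height hH h) cI.le
  have h3 := mul_le_mul_of_nonneg_left (iSup_rotStripClose_mono_height hH h) cP.le
  linarith

/-- **`F_{H+1} → 2 x_c cos(π/16)` as `H → ∞`** (the functional identity and the tree's `B_H → 0`).
[cite: Beaton2014RotatedHoneycomb, §4 and Appendix A, Corollary 15 (B(x_c,1) = 0); DuminilCopinSmirnov2012, §3] -/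
theorem tendsto_rot_arch_functional :
    Tendsto (fun H : ℕ =>
      2 * Real.sin (3 * Real.pi / 16) * (⨆ Wd : ℕ, rotGF ((rotStripV (H + 1) Wd).erase wOut) IsRotBotOut) +
        2 * Real.sin (Real.pi / 16) * (⨆ Wd : ℕ, rotGF ((rotStripV (H + 1) Wd).erase wOut) IsRotBotIn) +
        2 * Real.cos (7 * Real.pi / 16) * (⨆ Wd : ℕ, rotGF ((rotStripV (H + 1) Wd).erase wOut) IsRotCloseDart)) atTop
      (𝓝 (2 * hexCriticalFugacity * Real.cos (Real.pi / 16))) := by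
  have hB := ((tendsto_iSup_rotStripBR.comp (tendsto_add_atTop_nat 1)).const_mul (2 * Real.cos (Real.pi / 16))).const_sub
    (2 * hexCriticalFugacity * Real.cos (Real.pi / 16))
  simp only [mul_zero, sub_zero] at hB
  refine hB.congr' (Eventually.of_forall fun H => ?_)
  simp only [Function.comp_apply]
  exact (rot_arch_functional_eq (Nat.succ_pos H)).symm

/-- `c_O A^O_{H+1} ≤ 2 x_c cos(π/16)` (all `H`), hence `H ↦ A^O_{H+1}` is bounded. [cite: Beaton2014RotatedHoneycomb, §4] -/
theorem iSup_rotStripOut_bddAbove_height :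
    BddAbove (Set.range fun H : ℕ => ⨆ Wd : ℕ, rotGF ((rotStripV (H + 1) Wd).erase wOut) IsRotBotOut) := by
  obtain ⟨cO, cI, -, cP, cB⟩ := rot_coeff_pos
  refine ⟨2 * hexCriticalFugacity * Real.cos (Real.pi / 16) / (2 * Real.sin (3 * Real.pi / 16)), ?_⟩
  rintro _ ⟨H, rfl⟩
  rw [le_div_iff₀ cO, mul_comm]
  have l := rotStrip_identity_lim (Nat.succ_pos H)
  have h2 := mul_nonneg cI.le (Real.iSup_nonneg fun Wd => rotGF_nonneg ((rotStripV (H + 1) Wd).erase wOut) IsRotBotIn)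
  have h3 := mul_nonneg (by linarith : (0 : ℝ) ≤ 2 * Real.cos (Real.pi / 16))
    (Real.iSup_nonneg fun Wd => rotStripBR_nonneg (H + 1) Wd)
  have h4 := mul_nonneg cP.le (Real.iSup_nonneg fun Wd => rotGF_nonneg ((rotStripV (H + 1) Wd).erase wOut) IsRotCloseDart)
  linarith

/-- `H ↦ A^I_{H+1}` is bounded. [cite: Beaton2014RotatedHoneycomb, §4] -/
theorem iSup_rotStripIn_bddAbove_height :
    BddAbove (Set.range fun H : ℕ => ⨆ Wd : ℕ, rotGF ((rotStripV (H + 1) Wd).erase wOut) IsRotBotIn) := by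
  obtain ⟨cO, cI, -, cP, cB⟩ := rot_coeff_pos
  refine ⟨2 * hexCriticalFugacity * Real.cos (Real.pi / 16) / (2 * Real.sin (Real.pi / 16)), ?_⟩
  rintro _ ⟨H, rfl⟩
  rw [le_div_iff₀ cI, mul_comm]
  have l := rotStrip_identity_lim (Nat.succ_pos H)
  have h1 := mul_nonneg cO.le (Real.iSup_nonneg fun Wd => rotGF_nonneg ((rotStripV (H + 1) Wd).erase wOut) IsRotBotOut)
  have h3 := mul_nonneg (by linarith : (0 : ℝ) ≤ 2 * Real.cos (Real.pi / 16))
    (Real.iSup_nonneg fun Wd => rotStripBR_nonneg (H + 1) Wd)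
  have h4 := mul_nonneg cP.le (Real.iSup_nonneg fun Wd => rotGF_nonneg ((rotStripV (H + 1) Wd).erase wOut) IsRotCloseDart)
  linarith

/-- `H ↦ P_{H+1}` is bounded. [cite: Beaton2014RotatedHoneycomb, §4] -/
theorem iSup_rotStripClose_bddAbove_height :
    BddAbove (Set.range fun H : ℕ => ⨆ Wd : ℕ, rotGF ((rotStripV (H + 1) Wd).erase wOut) IsRotCloseDart) := by
  obtain ⟨cO, cI, -, cP, cB⟩ := rot_coeff_pos
  refine ⟨2 * hexCriticalFugacity * Real.cos (Real.pi / 16) / (2 * Real.cos (7 * Real.pi / 16)), ?_⟩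
  rintro _ ⟨H, rfl⟩
  rw [le_div_iff₀ cP, mul_comm]
  have l := rotStrip_identity_lim (Nat.succ_pos H)
  have h1 := mul_nonneg cO.le (Real.iSup_nonneg fun Wd => rotGF_nonneg ((rotStripV (H + 1) Wd).erase wOut) IsRotBotOut)
  have h2 := mul_nonneg cI.le (Real.iSup_nonneg fun Wd => rotGF_nonneg ((rotStripV (H + 1) Wd).erase wOut) IsRotBotIn)
  have h3 := mul_nonneg (by linarith : (0 : ℝ) ≤ 2 * Real.cos (Real.pi / 16))
    (Real.iSup_nonneg fun Wd => rotStripBR_nonneg (H + 1) Wd)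
  linarith

/-- **`A^O_∞ := lim_H A^O_{H+1}` exists** (`= ⨆_H A^O_{H+1}`): the bottom-out arch generating function of the rotated half-plane at `x_c` is
FINITE. [cite: Beaton2014RotatedHoneycomb, §4 (arXiv v3 p. 17); DuminilCopinSmirnov2012, §3 (A(x_c) finite, parallel frame)] -/
theorem tendsto_iSup_rotStripOut_atTop :
    Tendsto (fun H : ℕ => ⨆ Wd : ℕ, rotGF ((rotStripV (H + 1) Wd).erase wOut) IsRotBotOut) atTop
      (𝓝 (⨆ H : ℕ, ⨆ Wd : ℕ, rotGF ((rotStripV (H + 1) Wd).erase wOut) IsRotBotOut)) :=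
  tendsto_atTop_ciSup (fun _ _ h => iSup_rotStripOut_mono_height (Nat.succ_pos _) (by omega)) iSup_rotStripOut_bddAbove_height

/-- **`A^I_∞ := lim_H A^I_{H+1}` exists.** [cite: Beaton2014RotatedHoneycomb, §4; DuminilCopinSmirnov2012, §3] -/
theorem tendsto_iSup_rotStripIn_atTop :
    Tendsto (fun H : ℕ => ⨆ Wd : ℕ, rotGF ((rotStripV (H + 1) Wd).erase wOut) IsRotBotIn) atTop
      (𝓝 (⨆ H : ℕ, ⨆ Wd : ℕ, rotGF ((rotStripV (H + 1) Wd).erase wOut) IsRotBotIn)) :=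
  tendsto_atTop_ciSup (fun _ _ h => iSup_rotStripIn_mono_height (Nat.succ_pos _) (by omega)) iSup_rotStripIn_bddAbove_height

/-- **`P_∞ := lim_H P_{H+1}` exists.** [cite: Beaton2014RotatedHoneycomb, §4; DuminilCopinSmirnov2012, §3] -/
theorem tendsto_iSup_rotStripClose_atTop :
    Tendsto (fun H : ℕ => ⨆ Wd : ℕ, rotGF ((rotStripV (H + 1) Wd).erase wOut) IsRotCloseDart) atTop
      (𝓝 (⨆ H : ℕ, ⨆ Wd : ℕ, rotGF ((rotStripV (H + 1) Wd).erase wOut) IsRotCloseDart)) :=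
  tendsto_atTop_ciSup (fun _ _ h => iSup_rotStripClose_mono_height (Nat.succ_pos _) (by omega)) iSup_rotStripClose_bddAbove_height

/-- **CRITICAL ARCH IDENTITY (rotated frame, `y = 1`): `c_O A^O_∞ + c_I A^I_∞ + c_P P_∞ = 2 x_c cos(π/16)`** — Beaton's identity at
`H = W = ∞`: the bridge term is gone (`B(x_c, 1) = 0`) and so is the lateral one.  Rotated-frame twin of the parallel-frame critical arch
value `A(x_c) = lim_T A_T` (tree `HV.tendsto_stripAlim`).
[cite: Beaton2014RotatedHoneycomb, §4 (arXiv v3 p. 17: Prop. 11's hypothesis) and Appendix A (Corollary 15: B(x_c,1) = 0, arXiv v3 p. 19); DuminilCopinSmirnov2012, §3 (proof of Theorem 1, Z(x_c) = ∞ step)] -/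
theorem rot_critical_arch_identity :
    2 * Real.sin (3 * Real.pi / 16) * (⨆ H : ℕ, ⨆ Wd : ℕ, rotGF ((rotStripV (H + 1) Wd).erase wOut) IsRotBotOut) +
      2 * Real.sin (Real.pi / 16) * (⨆ H : ℕ, ⨆ Wd : ℕ, rotGF ((rotStripV (H + 1) Wd).erase wOut) IsRotBotIn) +
      2 * Real.cos (7 * Real.pi / 16) * (⨆ H : ℕ, ⨆ Wd : ℕ, rotGF ((rotStripV (H + 1) Wd).erase wOut) IsRotCloseDart) =
    2 * hexCriticalFugacity * Real.cos (Real.pi / 16) :=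
  tendsto_nhds_unique
    (((tendsto_iSup_rotStripOut_atTop.const_mul _).add (tendsto_iSup_rotStripIn_atTop.const_mul _)).add
      (tendsto_iSup_rotStripClose_atTop.const_mul _))
    tendsto_rot_arch_functional

/-- `A^O_{H+1} ≤ A^O_∞`. [cite: Beaton2014RotatedHoneycomb, §4] -/
theorem iSup_rotStripOut_le_iSup_iSup (H : ℕ) :
    (⨆ Wd : ℕ, rotGF ((rotStripV (H + 1) Wd).erase wOut) IsRotBotOut) ≤
      ⨆ H : ℕ, ⨆ Wd : ℕ, rotGF ((rotStripV (H + 1) Wd).erase wOut) IsRotBotOut :=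
  le_ciSup iSup_rotStripOut_bddAbove_height H

/-- `A^I_{H+1} ≤ A^I_∞`. [cite: Beaton2014RotatedHoneycomb, §4] -/
theorem iSup_rotStripIn_le_iSup_iSup (H : ℕ) :
    (⨆ Wd : ℕ, rotGF ((rotStripV (H + 1) Wd).erase wOut) IsRotBotIn) ≤
      ⨆ H : ℕ, ⨆ Wd : ℕ, rotGF ((rotStripV (H + 1) Wd).erase wOut) IsRotBotIn :=
  le_ciSup iSup_rotStripIn_bddAbove_height H

/-- `P_{H+1} ≤ P_∞`. [cite: Beaton2014RotatedHoneycomb, §4] -/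
theorem iSup_rotStripClose_le_iSup_iSup (H : ℕ) :
    (⨆ Wd : ℕ, rotGF ((rotStripV (H + 1) Wd).erase wOut) IsRotCloseDart) ≤
      ⨆ H : ℕ, ⨆ Wd : ℕ, rotGF ((rotStripV (H + 1) Wd).erase wOut) IsRotCloseDart :=
  le_ciSup iSup_rotStripClose_bddAbove_height H

/-- **HEIGHT BUDGET (locality of Beaton's arch classes in the height, EXACT):**
`c_O (A^O_∞ − A^O_{H+1}) + c_I (A^I_∞ − A^I_{H+1}) + c_P (P_∞ − P_{H+1}) = c_B B_{H+1}` — the total height-truncation error of the three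
arch classes is exactly `c_B` times the critical strip-bridge generating function.
[cite: Beaton2014RotatedHoneycomb, §4 (limit identity) and Appendix A (B(x_c,1) = 0); DuminilCopinSmirnov2012, §3] -/
theorem rot_height_budget (H : ℕ) :
    2 * Real.sin (3 * Real.pi / 16) * ((⨆ H : ℕ, ⨆ Wd : ℕ, rotGF ((rotStripV (H + 1) Wd).erase wOut) IsRotBotOut) -
        ⨆ Wd : ℕ, rotGF ((rotStripV (H + 1) Wd).erase wOut) IsRotBotOut) +
      2 * Real.sin (Real.pi / 16) * ((⨆ H : ℕ, ⨆ Wd : ℕ, rotGF ((rotStripV (H + 1) Wd).erase wOut) IsRotBotIn) -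
        ⨆ Wd : ℕ, rotGF ((rotStripV (H + 1) Wd).erase wOut) IsRotBotIn) +
      2 * Real.cos (7 * Real.pi / 16) * ((⨆ H : ℕ, ⨆ Wd : ℕ, rotGF ((rotStripV (H + 1) Wd).erase wOut) IsRotCloseDart) -
        ⨆ Wd : ℕ, rotGF ((rotStripV (H + 1) Wd).erase wOut) IsRotCloseDart) =
    2 * Real.cos (Real.pi / 16) * ⨆ Wd : ℕ, rotStripBR (H + 1) Wd := by
  have a := rot_critical_arch_identity
  have f := rot_arch_functional_eq (Nat.succ_pos H)
  linarith

/-- Height locality of the bottom-out arch class, weighted: `c_O (A^O_∞ − A^O_{H+1}) ≤ c_B B_{H+1}`.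
[cite: Beaton2014RotatedHoneycomb, §4; DuminilCopinSmirnov2012, §3] -/
theorem two_mul_sin_mul_iSup_rotStripOut_deficit_le (H : ℕ) :
    2 * Real.sin (3 * Real.pi / 16) * ((⨆ H : ℕ, ⨆ Wd : ℕ, rotGF ((rotStripV (H + 1) Wd).erase wOut) IsRotBotOut) -
        ⨆ Wd : ℕ, rotGF ((rotStripV (H + 1) Wd).erase wOut) IsRotBotOut) ≤
      2 * Real.cos (Real.pi / 16) * ⨆ Wd : ℕ, rotStripBR (H + 1) Wd := by
  obtain ⟨-, cI, -, cP, -⟩ := rot_coeff_pos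
  have b := rot_height_budget H
  have h2 := mul_nonneg cI.le (sub_nonneg.2 (iSup_rotStripIn_le_iSup_iSup H))
  have h3 := mul_nonneg cP.le (sub_nonneg.2 (iSup_rotStripClose_le_iSup_iSup H))
  linarith

/-- Height locality of the bottom-in arch class, weighted: `c_I (A^I_∞ − A^I_{H+1}) ≤ c_B B_{H+1}`.
[cite: Beaton2014RotatedHoneycomb, §4; DuminilCopinSmirnov2012, §3] -/
theorem two_mul_sin_mul_iSup_rotStripIn_deficit_le (H : ℕ) :
    2 * Real.sin (Real.pi / 16) * ((⨆ H : ℕ, ⨆ Wd : ℕ, rotGF ((rotStripV (H + 1) Wd).erase wOut) IsRotBotIn) -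
        ⨆ Wd : ℕ, rotGF ((rotStripV (H + 1) Wd).erase wOut) IsRotBotIn) ≤
      2 * Real.cos (Real.pi / 16) * ⨆ Wd : ℕ, rotStripBR (H + 1) Wd := by
  obtain ⟨cO, -, -, cP, -⟩ := rot_coeff_pos
  have b := rot_height_budget H
  have h1 := mul_nonneg cO.le (sub_nonneg.2 (iSup_rotStripOut_le_iSup_iSup H))
  have h3 := mul_nonneg cP.le (sub_nonneg.2 (iSup_rotStripClose_le_iSup_iSup H))
  linarith

/-- Height locality of the closing class, weighted: `c_P (P_∞ − P_{H+1}) ≤ c_B B_{H+1}`.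
[cite: Beaton2014RotatedHoneycomb, §4; DuminilCopinSmirnov2012, §3] -/
theorem two_mul_cos_mul_iSup_rotStripClose_deficit_le (H : ℕ) :
    2 * Real.cos (7 * Real.pi / 16) * ((⨆ H : ℕ, ⨆ Wd : ℕ, rotGF ((rotStripV (H + 1) Wd).erase wOut) IsRotCloseDart) -
        ⨆ Wd : ℕ, rotGF ((rotStripV (H + 1) Wd).erase wOut) IsRotCloseDart) ≤
      2 * Real.cos (Real.pi / 16) * ⨆ Wd : ℕ, rotStripBR (H + 1) Wd := by
  obtain ⟨cO, cI, -, -, -⟩ := rot_coeff_pos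
  have b := rot_height_budget H
  have h1 := mul_nonneg cO.le (sub_nonneg.2 (iSup_rotStripOut_le_iSup_iSup H))
  have h2 := mul_nonneg cI.le (sub_nonneg.2 (iSup_rotStripIn_le_iSup_iSup H))
  linarith

/-- **The arch functional's deficit decays at the tree's log rate:** there is `C` with
`2 x_c cos(π/16) − F_H ≤ C (log H)^{−1/3}` for every `H ≥ 2` (`= c_B B_H`, tree `iSup_rotStripBR_le_log`, `c_B ≤ 2`).
[cite: Beaton2014RotatedHoneycomb, §4 and Appendix A; GlazmanManolescu2019, Proposition 1.1 and §4.1 (the log rate)] -/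
theorem rot_arch_deficit_le_log : ∃ C : ℝ, ∀ H : ℕ, 2 ≤ H →
    2 * hexCriticalFugacity * Real.cos (Real.pi / 16) -
        (2 * Real.sin (3 * Real.pi / 16) * (⨆ Wd : ℕ, rotGF ((rotStripV H Wd).erase wOut) IsRotBotOut) +
          2 * Real.sin (Real.pi / 16) * (⨆ Wd : ℕ, rotGF ((rotStripV H Wd).erase wOut) IsRotBotIn) +
          2 * Real.cos (7 * Real.pi / 16) * (⨆ Wd : ℕ, rotGF ((rotStripV H Wd).erase wOut) IsRotCloseDart)) ≤
      C * Real.log H ^ (-(1 : ℝ) / 3) := by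
  obtain ⟨C, hC⟩ := iSup_rotStripBR_le_log
  refine ⟨2 * Real.cos (Real.pi / 16) * C, fun H hH => ?_⟩
  obtain ⟨-, -, -, -, cB⟩ := rot_coeff_pos
  have f := rot_arch_functional_eq (show 1 ≤ H by omega)
  have hB := mul_le_mul_of_nonneg_left (hC H hH) (by linarith : (0 : ℝ) ≤ 2 * Real.cos (Real.pi / 16))
  rw [mul_assoc]
  linarith

/-- **Height locality of the bottom-out arch class with the tree's log rate:** there is `C` with
`A^O_∞ − A^O_H ≤ C (log H)^{−1/3}` for every `H ≥ 2`. [cite: Beaton2014RotatedHoneycomb, §4; GlazmanManolescu2019, Proposition 1.1] -/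
theorem iSup_rotStripOut_deficit_le_log : ∃ C : ℝ, ∀ H : ℕ, 2 ≤ H →
    (⨆ H : ℕ, ⨆ Wd : ℕ, rotGF ((rotStripV (H + 1) Wd).erase wOut) IsRotBotOut) -
        (⨆ Wd : ℕ, rotGF ((rotStripV H Wd).erase wOut) IsRotBotOut) ≤ C * Real.log H ^ (-(1 : ℝ) / 3) := by
  obtain ⟨C, hC⟩ := iSup_rotStripBR_le_log
  refine ⟨2 * Real.cos (Real.pi / 16) / (2 * Real.sin (3 * Real.pi / 16)) * C, fun H hH => ?_⟩
  obtain ⟨cO, -, -, -, cB⟩ := rot_coeff_pos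
  obtain ⟨K, rfl⟩ : ∃ K, H = K + 1 := ⟨H - 1, by omega⟩
  have b := two_mul_sin_mul_iSup_rotStripOut_deficit_le K
  have hlog : 0 ≤ Real.log ((K + 1 : ℕ) : ℝ) ^ (-(1 : ℝ) / 3) :=
    Real.rpow_nonneg (Real.log_nonneg (by norm_cast; omega)) _
  have hB := mul_le_mul_of_nonneg_left (hC (K + 1) hH) (by linarith : (0 : ℝ) ≤ 2 * Real.cos (Real.pi / 16))
  rw [mul_assoc, div_mul_eq_mul_div, le_div_iff₀ cO, mul_comm]
  linarith

/-- The bridge width limit is the only obstruction to the arch identity at finite height: `F_H = 2 x_c cos(π/16) ↔ B_H = 0`, and the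
tree's `B_H > 0` makes the right side false — recorded as the strict inequality `rot_arch_functional_lt`; here the equivalent form
`c_B B_H = 2 x_c cos(π/16) − F_H > 0`. [cite: Beaton2014RotatedHoneycomb, §4] -/
theorem rot_arch_deficit_pos {H : ℕ} (hH : 1 ≤ H) :
    0 < 2 * hexCriticalFugacity * Real.cos (Real.pi / 16) -
        (2 * Real.sin (3 * Real.pi / 16) * (⨆ Wd : ℕ, rotGF ((rotStripV H Wd).erase wOut) IsRotBotOut) +
          2 * Real.sin (Real.pi / 16) * (⨆ Wd : ℕ, rotGF ((rotStripV H Wd).erase wOut) IsRotBotIn) +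
          2 * Real.cos (7 * Real.pi / 16) * (⨆ Wd : ℕ, rotGF ((rotStripV H Wd).erase wOut) IsRotCloseDart)) := by
  have := rot_arch_functional_lt hH
  linarith

end Literature.Probability.RandomPlanarGeometry.SAW.HV

end
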